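import Summits.QuantumFields.YangMills.Theorems.UnitScaleTiltProp7TowerCovConstExt
import Summits.QuantumFields.YangMills.Theorems.UnitScaleTiltProp7SymAvgTwDefs
import Summits.QuantumFields.YangMills.Theorems.UnitScaleTiltProp7AxialReprPrint
import Literature.MathematicalPhysics.QuantumFieldTheory.Balaban1983to89.B7AvgPeriodicity
import HarnessLib

/-!
# Route `UnitScaleTilt`, crux K1 child «MinimiserStabilityRegPr» (stmt-QuantumFields-19200), stub EX, route (α), node (AVG-SYM) — (46)-tw: **THE `ȟ` SUPPLIER AT THE T³
# LETTERS** — the covariantly-constant extension `ȟ : (coarse gauge data on T^{(0)}_n) →ₗ[ℂ] (fine gauge parameters on T^{(0)}_K)` of OWNER RULING g26-№1 (2)∕(3e), delivered as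
# the quadruple `(hExt, hExt_centre, hExt_ax, hExt_b)` of ★w5-20520 g3's capstone `Prop7SymAvgTwOfRegPr.exists_rightInv_QTw_of_regPr` VERBATIM — `hExt_ax` for EVERY `t : ℂ`
# and `C_Γ = 2`

Cell `ym3-torus`, width seat `ym-ust-20520-w3` (gen 4); ★★OWNER g26 ACK 15 (b) «★w3-20520 g4 := the ȟ SUPPLIER».  THEOREMS ONLY (0 `def`, 0 `sorry`; the three `ℤᵈ` definitions are
`Prop7TowerCovConstExt`'s).  YM₃ on T³ is a ladder rung (R3), NOT the Clay problem; nothing here claims the stub, the crux, d = 4 or the mass gap.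
`--supports stmt-QuantumFields-19200 --as helper`; count-neutral.

THE CONSTRUCTION ([Balaban1985RegularSpaces] (1.19) p. 79, p. 98; [Balaban1985BackgroundPropagators] (3.18)–(3.21) p. 393).  On the pulled-back background
`V := (U₀♭)♯_{x₀}` (`x₀ = basePt F n K`, the `k`-centre `embIter k 0`, `k = K − n`) let `ccExt` be `Prop7TowerCovConstExt`'s extension (value at the `k`-corner transported down the tower
of averages).  Read on the torus through the canonical coordinates of a fine site relative to `x₀` and the canonical level-`k` labels of the coarse sites, it is the `ℂ`-linear map
`ȟ`; (i) at the `k`-centres `embIter k (siteShift y) = x₀ + Lᵏ·ỹ` (`Prop7AxialReprPrint.embIter_eq_transl`) it returns `η y` (`ccExt_pow_smul` + periodicity); (ii) the pullback of the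
GL gauge `e^{t·ȟη}` IS `e^{t·ccExt}` (`pull_gaugeActT` + periodicity), so `Prop7TowerCovConstExt.inAx_gaugeAct_ccExt` gives `(U₀♭)^{e^{t·ȟη}} ∈ Ax_k(𝔅_k, U₀)` for EVERY `t`; (iii) the
averages of `V` below level `k` are `SU(2)`-valued at a `RegPr` background ([Balaban1985Averaging] Prop. 2: `avgIter_mem` under `inAk_pull_of_regPr`∕`pdev_pull_lt`), so
`‖ȟη(x)‖ ≤ ‖η‖` (`norm_ccExt_le`) and `‖D_{U₀}ȟη‖ ≤ 2‖η‖`.  PERIODICITY (§1, `ℤᵈ`): the within-tower transport, hence `ccExt`, is invariant under the lattice `Lᵏ·N_k·ℤᵈ` when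
the averages are (`B7AvgPeriodicity.avgIter_periodic` ∘ the `N₀ℤᵈ`-periodicity of a pullback).

WHAT THIS FILE PROVES.  §1 (`ℤᵈ`, generic): `fl_add_smul`, `iterate_fl_add_pow_smul`, `axialFn_shiftCfg`, ★`tg_truncTower_add_period`, `towerT_add_period`, ★`ccExt_add_period`.
§2 (T³): `pull_shiftCfg_period` (the based pullback is `N₀ℤᵈ`-periodic), `avgIter_pull_periodic`, `coord0`-lemmas (`transl_coord0`, `coord0_transl`), `ccExt_coord0_transl`,
★★★ `exists_covConstExt` — THE QUADRUPLE: `∃ hExt : (Site (F.P n) 0 → M₂) →ₗ[ℂ] (Site (F.P K) 0 → M₂)`, `hExt η (embIter (K−n) (siteShift (sites_eq F n K h) y)) = η y`,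
`∀ t, InAx … (pull (bgUnits F K U₀) (basePt F n K)) (pull (gaugeActT (fun x => expUnit (t • hExt η x)) (bgUnits F K U₀)) (basePt F n K))`, and
`‖fun b => hExt η b.src − ↑(U₀♭ b)·hExt η b.tgt·↑(U₀♭ b)⁻¹‖ ≤ 2‖η‖` — under `RegPr F n K ε₀ U₀`, `0 < ε₀`, and the two Prop.-2 windows `C0·(2ε₀) ≤ ⅓`, `4(2ε₀) ≤ c₂′` of the capstone.
HONEST SCOPE.  Bookkeeping over `Prop7TowerCovConstExt` and the tree's torus∕`ℤᵈ` dictionary; the only analytic input is [Balaban1985Averaging] Prop. 2 (averages stay in `SU(2)`), by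
name.  (45)-tw `R(U₀)D*H = 0` and the `G′(U₀)` correction are NOT claimed.

References: T. Bałaban, CMP **99** (1985) 75–102 [Balaban1985RegularSpaces] ((1.14) p.78, (1.19) p.79, p.98); CMP **98** (1985) 17–51 [Balaban1985Averaging] ((8) p.18, (11) p.19,
Prop. 2 p.22, p.24, p.28); CMP **99** (1985) 389–434 [Balaban1985BackgroundPropagators] ((3.18)–(3.21) p.393); CMP **109** (1987) 249–301 [Balaban1987RG1] ((0.1) p.251).
-/

set_option autoImplicit false

noncomputable section

open scoped BigOperators Matrix.Norms.L2Operator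

namespace Summit.QuantumFields.YangMills.Theorems.Prop7SymAvgTwCovConstExt

open NormedSpace
open Literature.MathematicalPhysics.QuantumFieldTheory.Balaban1983to89
open B7Prop1Explicit renaming Site → LSite
open B7Prop1Explicit (e boxVec gaugeAct hol axialFn treeWord expUnit val_expUnit U1)
open B7Prop2Explicit (avgIter pdev C0 c2' AvgClosed avgIter_mem)
open B7AvgGaugeCovariance (uLev)
open B7AvgPeriodicity (avgIter_periodic)
open B12Ineq417Flat (shiftCfg shiftCfg_apply hol_shiftCfg)
open B8Ineq130 (fl axialFn_one)
open B8Eq115GaugeFixing (tg tg_zero tg_succ fl_smul fl_block)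
open B8Eq119TwistedAxial (InAx)
open Summit.QuantumFields.YangMills.Theorems.Prop7TowerCovConstExt (truncTower towerT ccExt truncTower_of_lt truncTower_top towerT_def ccExt_apply ccExt_pow_smul ccExt_add ccExt_smul
  inAx_gaugeAct_ccExt norm_ccExt_le iterate_fl_pow_smul)

/-! ## §1 (`ℤᵈ`) Periodicity of the within-tower transport and of the extension -/

section Periodic

variable {d : ℕ}

/-- `fl (x + L·v) = fl x + v` (floor division is translation-covariant under `Lℤᵈ`). [folklore] -/
theorem fl_add_smul {L : ℕ} (hL : 1 ≤ L) (x v : LSite d) : fl L (x + (L : ℤ) • v) = fl L x + v := by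
  funext i
  have hL0 : (L : ℤ) ≠ 0 := by exact_mod_cast (by omega : L ≠ 0)
  simp only [fl, Pi.add_apply, Pi.smul_apply, smul_eq_mul]
  exact Int.add_mul_ediv_left (x i) (v i) hL0

/-- `flⁿ (x + Lⁿ·v) = flⁿ x + v`. [folklore] -/
theorem iterate_fl_add_pow_smul {L : ℕ} (hL : 1 ≤ L) : ∀ (n : ℕ) (x v : LSite d), (fl L)^[n] (x + ((L : ℤ) ^ n) • v) = (fl L)^[n] x + v
  | 0, x, v => by simp
  | n + 1, x, v => by
    rw [Function.iterate_succ_apply, Function.iterate_succ_apply, pow_succ', mul_smul, fl_add_smul hL, iterate_fl_add_pow_smul hL n]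

variable {G : Type*} [Group G]

/-- Tree transports of a translated configuration: `axialFn (t_bW) y z = axialFn W (y + b) (z + b)`. [cite: Balaban1985Averaging, (9) p.18] -/
theorem axialFn_shiftCfg (b : LSite d) (W : LSite d → Fin d → G) (y z : LSite d) :
    axialFn (shiftCfg b W) y z = axialFn W (y + b) (z + b) := by
  unfold axialFn
  rw [hol_shiftCfg, add_sub_add_right_eq_sub]

variable {𝔸 : Type*} [NormedRing 𝔸] [NormOneClass 𝔸] [NormedAlgebra ℂ 𝔸] [CompleteSpace 𝔸]

omit [NormOneClass 𝔸] in
/-- ★ **THE TOWER GAUGE OF THE TRUNCATED TOWER IS PERIODIC** under a top-lattice vector `a` whenever every average below level `k` is periodic under the corresponding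
multiple: `tg … n (x + Lⁿ·a) = tg … n x` for all depths `n ≤ k` (induction on the recursion `u_j(x) = u_{j+1}(fl x)·Ū₀ʲ(Γ_{L·fl x, x})`; the switched-off top level is constant).
[cite: Balaban1985RegularSpaces, p.98; Balaban1987RG1, (0.1) p.251] -/
theorem tg_truncTower_add_period {L : ℕ} (hL : 1 ≤ L) (V : LSite d → Fin d → 𝔸ˣ) (k : ℕ) (a : LSite d)
    (hper : ∀ n, n < k → shiftCfg (((L : ℤ) ^ (n + 1)) • a) (avgIter L V (k - (n + 1))) = avgIter L V (k - (n + 1))) :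
    ∀ n, n ≤ k → ∀ x : LSite d, tg L (truncTower L V k) k 0 n (x + ((L : ℤ) ^ n) • a) = tg L (truncTower L V k) k 0 n x
  | 0, _, x => by rw [tg_zero, truncTower_top, axialFn_one, axialFn_one]
  | n + 1, hn, x => by
    have hfl : fl L (x + ((L : ℤ) ^ (n + 1)) • a) = fl L x + ((L : ℤ) ^ n) • a := by
      rw [pow_succ', mul_smul, fl_add_smul hL]
    have hW : truncTower L V k (k - (n + 1)) = avgIter L V (k - (n + 1)) := truncTower_of_lt L V k (by omega)
    rw [tg_succ, tg_succ, hfl, tg_truncTower_add_period hL V k a hper n (by omega) (fl L x), hW]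
    congr 1
    rw [smul_add, smul_smul, ← pow_succ', ← axialFn_shiftCfg (((L : ℤ) ^ (n + 1)) • a), hper n (by omega)]

omit [NormOneClass 𝔸] in
/-- The within-tower transport is periodic: `towerT (w + Lᵏ·a) = towerT w`. [cite: Balaban1985RegularSpaces, p.98] -/
theorem towerT_add_period {L : ℕ} (hL : 1 ≤ L) (V : LSite d → Fin d → 𝔸ˣ) (k : ℕ) (a : LSite d)
    (hper : ∀ n, n < k → shiftCfg (((L : ℤ) ^ (n + 1)) • a) (avgIter L V (k - (n + 1))) = avgIter L V (k - (n + 1))) (w : LSite d) :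
    towerT L V k (w + ((L : ℤ) ^ k) • a) = towerT L V k w := by
  rw [towerT_def]
  exact tg_truncTower_add_period hL V k a hper k le_rfl w

omit [NormOneClass 𝔸] in
/-- ★ **THE EXTENSION IS PERIODIC**: `ccExt η̃ (w + Lᵏ·a) = ccExt η̃ w` when the averages below level `k` and the top datum are. [cite: Balaban1987RG1, (0.1) p.251] -/
theorem ccExt_add_period {L : ℕ} (hL : 1 ≤ L) (V : LSite d → Fin d → 𝔸ˣ) (k : ℕ) (a : LSite d)
    (hper : ∀ n, n < k → shiftCfg (((L : ℤ) ^ (n + 1)) • a) (avgIter L V (k - (n + 1))) = avgIter L V (k - (n + 1)))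
    (η : LSite d → 𝔸) (hη : ∀ q, η (q + a) = η q) (w : LSite d) :
    ccExt L V k η (w + ((L : ℤ) ^ k) • a) = ccExt L V k η w := by
  rw [ccExt_apply, ccExt_apply, towerT_add_period hL V k a hper, iterate_fl_add_pow_smul hL, hη]

end Periodic


/-! ## §2 (T³) The based pullback is `N₀ℤᵈ`-periodic; canonical coordinates; the extension read on the torus -/

section Torus

open Literature.MathematicalPhysics.QuantumFieldTheory.Balaban1983to89.T3ContinuumYM3Torus
open T3LevelShift (siteShift siteShift_apply coordEquiv_val)
open T3PrintedRegularOrbits (sites_eq)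
open T3PrintedRegularMinimiser (RegPr)
open T3SectALandauChart (bgUnits pos_of_regPr)
open B7Prop2SpecialUnitary (specialUnitaryUnits)
open B7AvgClosedSpecialUnitarySharp (avgClosed_specialUnitary_of_le_twentyone)
open B8Thm2SetupTorus (unitsField_toUField_mem)
open B8Thm4TorusAt (torusLam)
open B15DeterminingSets (embIter)
open B10Eq27TorusAxialLog (transl transl_apply pull pull_apply gaugeActT pull_gaugeActT unitsField toUField)
open Summit.QuantumFields.YangMills.Theorems.Prop7SPrint (basePt)
open Summit.QuantumFields.YangMills.Theorems.Prop7FlatHolonomy (sitesPerDir_zero_eq_mul_pow)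
open Summit.QuantumFields.YangMills.Theorems.Prop7AxialReprPrint (embIter_eq_transl pull_toUField_mem pdev_pull_lt inAk_pull_of_regPr)

variable (F : T3Family) {n K : ℕ} (h : n ≤ K)

/-- **THE BASED PULLBACK OF A TORUS FIELD IS PERIODIC UNDER THE WHOLE LATTICE `N₀ℤ³`**, `N₀ = sitesPerDir 0`. [cite: Balaban1985RegularSpaces, (1.3) p.77] -/
theorem pull_shiftCfg_period {G : Type*} (B : GaugeField (F.P K) 0 G) (x₀ : Site (F.P K) 0) (a : LSite (F.P K).d) :
    shiftCfg ((((F.P K).sitesPerDir 0 : ℕ) : ℤ) • a) (pull B x₀) = pull B x₀ := by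
  funext z μ
  rw [shiftCfg_apply, pull_apply, pull_apply]
  congr 2
  funext ν
  rw [transl_apply, transl_apply, Pi.add_apply, Pi.smul_apply, smul_eq_mul, Int.cast_add, Int.cast_mul, Int.cast_natCast, ZMod.natCast_self,
    zero_mul, add_zero]

/-- The averages of the based pullback below level `k = K − n` are periodic under `L^{k−j}·N_k·ℤ³`, `N_k = sitesPerDir (K − n)` (`B7AvgPeriodicity.avgIter_periodic`): the form `hper`
of `Prop7SymAvgTwCovConstExt.ccExt_add_period` for the top-lattice vector `N_k·m`. [cite: Balaban1985Averaging, (43) p.24; Balaban1987RG1, (0.1) p.251] -/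
theorem avgIter_pull_hper {G : Type*} [NormedRing G] [NormOneClass G] [NormedAlgebra ℂ G] [CompleteSpace G] (B : GaugeField (F.P K) 0 Gˣ) (m : LSite (F.P K).d) :
    ∀ j, j < K - n → shiftCfg ((((F.P K).L : ℤ) ^ (j + 1)) • (((((F.P K).sitesPerDir (K - n)) : ℕ) : ℤ) • m))
      (avgIter (F.P K).L (pull B (basePt F n K)) (K - n - (j + 1))) = avgIter (F.P K).L (pull B (basePt F n K)) (K - n - (j + 1)) := by
  intro j hj
  have hk : K - n ≤ (F.P K).m + (F.P K).K := by show K - n ≤ F.m + K; omega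
  have hN : (((F.P K).sitesPerDir 0 : ℕ) : ℤ) = ((((F.P K).sitesPerDir (K - n)) : ℕ) : ℤ) * ((F.P K).L : ℤ) ^ (K - n) := by
    rw [sitesPerDir_zero_eq_mul_pow hk]; push_cast; ring
  rw [smul_smul]
  refine avgIter_periodic (F.P K).L (pull B (basePt F n K)) (K - n - (j + 1)) (T := ((F.P K).L : ℤ) ^ (j + 1) * ((((F.P K).sitesPerDir (K - n)) : ℕ) : ℤ))
    (fun a => ?_) m
  have e : ((F.P K).L : ℤ) ^ (K - n - (j + 1)) * (((F.P K).L : ℤ) ^ (j + 1) * ((((F.P K).sitesPerDir (K - n)) : ℕ) : ℤ)) = (((F.P K).sitesPerDir 0 : ℕ) : ℤ) := by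
    rw [hN, ← mul_assoc, ← pow_add, Nat.sub_add_cancel (by omega : j + 1 ≤ K - n)]; ring
  rw [e]
  exact pull_shiftCfg_period F B (basePt F n K) a

/-- **THE CANONICAL `ℤ³` COORDINATES OF A FINE SITE RELATIVE TO THE BASE POINT `x₀ = basePt F n K`** (representatives in `[0, N₀)`). [cite: Balaban1987RG1, (0.1) p.251] -/
theorem transl_coord0 (x : Site (F.P K) 0) :
    transl (basePt F n K) (fun μ => (((x μ - basePt F n K μ).val : ℕ) : ℤ)) = x := by
  funext ν
  rw [transl_apply, Int.cast_natCast, ZMod.natCast_zmod_val, add_sub_cancel]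

/-- The coordinates of `x₀ + w` differ from `w` by a vector of the period lattice `N₀ℤ³`. [cite: Balaban1987RG1, (0.1) p.251] -/
theorem coord0_transl (w : LSite (F.P K).d) :
    (fun μ => (((transl (basePt F n K) w μ - basePt F n K μ).val : ℕ) : ℤ)) =
      w + (((F.P K).sitesPerDir 0 : ℕ) : ℤ) • fun μ => -(w μ / (((F.P K).sitesPerDir 0 : ℕ) : ℤ)) := by
  funext ν
  rw [transl_apply, add_sub_cancel_left, ZMod.val_intCast, Pi.add_apply, Pi.smul_apply, smul_eq_mul, Int.emod_def]
  ring

variable {F}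

/-- ★ **THE EXTENSION READ AT `x₀ + w` IS THE `ℤ³` EXTENSION AT `w`** (periodicity under `N₀ℤ³ = Lᵏ·N_k·ℤ³` of `ccExt` on the based pullback, top datum `N_k`-periodic).
[cite: Balaban1987RG1, (0.1) p.251; Balaban1985RegularSpaces, p.98] -/
theorem ccExt_coord0_transl (B : GaugeField (F.P K) 0 (Matrix (Fin 2) (Fin 2) ℂ)ˣ) (ηt : LSite (F.P K).d → Matrix (Fin 2) (Fin 2) ℂ)
    (hηt : ∀ (q m : LSite (F.P K).d), ηt (q + ((((F.P K).sitesPerDir (K - n)) : ℕ) : ℤ) • m) = ηt q) (w : LSite (F.P K).d) :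
    ccExt (F.P K).L (pull B (basePt F n K)) (K - n) ηt (fun μ => (((transl (basePt F n K) w μ - basePt F n K μ).val : ℕ) : ℤ)) =
      ccExt (F.P K).L (pull B (basePt F n K)) (K - n) ηt w := by
  have hk : K - n ≤ (F.P K).m + (F.P K).K := by show K - n ≤ F.m + K; omega
  have hL1 : 1 ≤ (F.P K).L := (F.P K).L_pos
  set m : LSite (F.P K).d := fun μ => -(w μ / (((F.P K).sitesPerDir 0 : ℕ) : ℤ)) with hm
  have hN : (((F.P K).sitesPerDir 0 : ℕ) : ℤ) • m = (((F.P K).L : ℤ) ^ (K - n)) • ((((F.P K).sitesPerDir (K - n) : ℕ) : ℤ) • m) := by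
    rw [smul_smul, sitesPerDir_zero_eq_mul_pow hk]; push_cast; rw [mul_comm]
  rw [coord0_transl F (n := n) (K := K) w, ← hm, hN]
  exact ccExt_add_period hL1 (pull B (basePt F n K)) (K - n) _ (avgIter_pull_hper F (n := n) (K := K) B m) ηt (fun q => hηt q m) w

include h in
/-- **THE TOP DATUM**: a coarse gauge parameter `η` on `T^{(0)}_n` read on the `ℤ³` labels of the level-`k` lattice (periodic under `N_k ℤ³`). [cite: Balaban1987RG1, (0.1) p.251] -/
theorem topDatum_periodic (η : Site (F.P n) 0 → Matrix (Fin 2) (Fin 2) ℂ) (q m : LSite (F.P K).d) :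
    (fun q' : LSite (F.P K).d => η (fun ν => ((q' ν : ℤ) : ZMod ((F.P n).sitesPerDir 0)))) (q + ((((F.P K).sitesPerDir (K - n)) : ℕ) : ℤ) • m) =
      (fun q' : LSite (F.P K).d => η (fun ν => ((q' ν : ℤ) : ZMod ((F.P n).sitesPerDir 0)))) q := by
  have hs : (F.P K).sitesPerDir (K - n) = (F.P n).sitesPerDir 0 := (sites_eq F n K h).symm
  simp only []
  congr 1
  funext ν
  rw [Pi.add_apply, Pi.smul_apply, smul_eq_mul, Int.cast_add, Int.cast_mul, Int.cast_natCast, hs, ZMod.natCast_self, zero_mul, add_zero]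

/-- ★★★ **THE `ȟ` SUPPLIER — THE COVARIANTLY-CONSTANT EXTENSION AT THE T³ LETTERS, WITH ITS THREE ROWS.**  For a member `(F, n, K)`, `n ≤ K`, a background `U₀ ∈ 𝔘_k(ε₀)`
(`RegPr F n K ε₀ U₀`, `0 < ε₀`) inside [Balaban1985Averaging] Prop. 2's window (`C₀·(2ε₀) ≤ ⅓`, `4(2ε₀) ≤ c₂′`): there is a `ℂ`-linear `ȟ` from coarse gauge parameters
`η : T^{(0)}_n → M₂` to fine ones with (i) `ȟ(η)` AT THE `k`-CENTRES = `η` (`ȟ η (embIter (K−n) (siteShift y)) = η y`); (ii) for EVERY `t : ℂ` the gauge curve `(U₀♭)^{e^{t·ȟη}}` lies in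
print's axial surface `Ax_k(𝔅_k, U₀)` — `InAx` of the based pullbacks ([Balaban1985RegularSpaces] (1.19)); (iii) `‖D_{U₀}ȟ(η)‖ ≤ 2‖η‖` (sup norms).  These are the binders
`hExt`∕`hExt_centre`∕`hExt_ax` (∀ t ⇒ ∀ᶠ t)∕`hExt_b` (`C_Γ = 2`) of `Prop7SymAvgTwOfRegPr.exists_rightInv_QTw_of_regPr`.
[cite: Balaban1985RegularSpaces, (1.14) p.78, (1.19) p.79, p.98; Balaban1985BackgroundPropagators, (3.18)-(3.21) p.393; Balaban1985Averaging, (11) p.19, Prop. 2 p.22, p.28] -/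
theorem exists_covConstExt {ε₀ : ℝ} (hε₀ : 0 < ε₀) (hα3 : C0 (F.P K).d * (2 * ε₀) ≤ 1 / 3) (hα4 : 4 * (2 * ε₀) ≤ c2' (F.P K).d (F.P K).L)
    (U₀ : GaugeField (F.P K) 0 (Matrix.specialUnitaryGroup (Fin 2) ℂ)) (hreg : RegPr F n K ε₀ U₀) :
    ∃ hExt : (Site (F.P n) 0 → Matrix (Fin 2) (Fin 2) ℂ) →ₗ[ℂ] (Site (F.P K) 0 → Matrix (Fin 2) (Fin 2) ℂ),
      (∀ (η : Site (F.P n) 0 → Matrix (Fin 2) (Fin 2) ℂ) (y : Site (F.P n) 0), hExt η (embIter (K - n) (siteShift (sites_eq F n K h) y)) = η y) ∧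
      (∀ (η : Site (F.P n) 0 → Matrix (Fin 2) (Fin 2) ℂ) (t : ℂ),
        InAx (F.P K).L (K - n) (torusLam (K - n)) (pull (bgUnits F K U₀) (basePt F n K))
          (pull (gaugeActT (fun x => expUnit (t • hExt η x)) (bgUnits F K U₀)) (basePt F n K))) ∧
      (∀ η : Site (F.P n) 0 → Matrix (Fin 2) (Fin 2) ℂ,
        ‖(fun b : PBond (F.P K) 0 => hExt η b.src - ((bgUnits F K U₀ b : (Matrix (Fin 2) (Fin 2) ℂ)ˣ) : Matrix (Fin 2) (Fin 2) ℂ) * hExt η b.tgt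
            * (((bgUnits F K U₀ b)⁻¹ : (Matrix (Fin 2) (Fin 2) ℂ)ˣ) : Matrix (Fin 2) (Fin 2) ℂ))‖ ≤ 2 * ‖η‖) := by
  -- letters
  have hk : K - n ≤ (F.P K).m + (F.P K).K := by show K - n ≤ F.m + K; omega
  have hL1 : 1 ≤ (F.P K).L := (F.P K).L_pos
  have hL2 : 2 ≤ (F.P K).L := by
    obtain ⟨c, hc⟩ := F.hL.1
    have h1 := F.hL.2
    show 2 ≤ F.L
    omega
  set V : LSite (F.P K).d → Fin (F.P K).d → (Matrix (Fin 2) (Fin 2) ℂ)ˣ := pull (bgUnits F K U₀) (basePt F n K) with hV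
  -- the top datum and the torus reading of `ccExt`
  let top : (Site (F.P n) 0 → Matrix (Fin 2) (Fin 2) ℂ) → LSite (F.P K).d → Matrix (Fin 2) (Fin 2) ℂ :=
    fun η q => η (fun ν => ((q ν : ℤ) : ZMod ((F.P n).sitesPerDir 0)))
  let coord : Site (F.P K) 0 → LSite (F.P K).d := fun x μ => (((x μ - basePt F n K μ).val : ℕ) : ℤ)
  let hExt : (Site (F.P n) 0 → Matrix (Fin 2) (Fin 2) ℂ) →ₗ[ℂ] (Site (F.P K) 0 → Matrix (Fin 2) (Fin 2) ℂ) :=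
    { toFun := fun η x => ccExt (F.P K).L V (K - n) (top η) (coord x)
      map_add' := fun η η' => by
        funext x
        have htop : top (η + η') = top η + top η' := rfl
        simp only [htop, ccExt_add, Pi.add_apply]
      map_smul' := fun c η => by
        funext x
        have htop : top (c • η) = c • top η := rfl
        simp only [htop, ccExt_smul, Pi.smul_apply, RingHom.id_apply] }
  have hExt_apply : ∀ η x, hExt η x = ccExt (F.P K).L V (K - n) (top η) (coord x) := fun _ _ => rfl
  have htop_per : ∀ (η : Site (F.P n) 0 → Matrix (Fin 2) (Fin 2) ℂ) (q m : LSite (F.P K).d),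
      top η (q + ((((F.P K).sitesPerDir (K - n)) : ℕ) : ℤ) • m) = top η q := fun η q m => topDatum_periodic h η q m
  -- ★ the reading at `x₀ + w`
  have hread : ∀ (η : Site (F.P n) 0 → Matrix (Fin 2) (Fin 2) ℂ) (w : LSite (F.P K).d),
      hExt η (transl (basePt F n K) w) = ccExt (F.P K).L V (K - n) (top η) w := fun η w => by
    rw [hExt_apply]
    exact ccExt_coord0_transl (bgUnits F K U₀) (top η) (htop_per η) w
  refine ⟨hExt, fun η y => ?_, fun η t => ?_, fun η => ?_⟩
  · -- (i) the centre row
    have hc : embIter (K - n) (siteShift (sites_eq F n K h) y) =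
        transl (basePt F n K) ((((F.P K).L : ℤ) ^ (K - n)) • fun μ : Fin (F.P K).d => (((siteShift (sites_eq F n K h) y μ).val : ℕ) : ℤ)) :=
      embIter_eq_transl (P := F.P K) hk (siteShift (sites_eq F n K h) y)
    calc hExt η (embIter (K - n) (siteShift (sites_eq F n K h) y))
        = hExt η (transl (basePt F n K) ((((F.P K).L : ℤ) ^ (K - n)) • fun μ : Fin (F.P K).d => (((siteShift (sites_eq F n K h) y μ).val : ℕ) : ℤ))) :=
          congrArg (hExt η) hc
      _ = ccExt (F.P K).L V (K - n) (top η) ((((F.P K).L : ℤ) ^ (K - n)) • fun μ : Fin (F.P K).d => (((siteShift (sites_eq F n K h) y μ).val : ℕ) : ℤ)) :=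
          hread η _
      _ = top η (fun μ : Fin (F.P K).d => (((siteShift (sites_eq F n K h) y μ).val : ℕ) : ℤ)) := ccExt_pow_smul hL1 V (K - n) (top η) _
      _ = η y := by
          show η (fun ν => ((((siteShift (sites_eq F n K h) y ν).val : ℕ) : ℤ) : ZMod ((F.P n).sitesPerDir 0))) = η y
          congr 1
          funext ν
          rw [siteShift_apply, coordEquiv_val, Int.cast_natCast]
          exact ZMod.natCast_zmod_val (y ν)
  · -- (ii) the gauge curve stays in `Ax_k(𝔅_k, U₀)`, for every `t`
    rw [pull_gaugeActT]
    simp only [hread]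
    exact inAx_gaugeAct_ccExt hL1 V (K - n) (top η) t (torusLam (K - n))
  · -- (iii) `‖D_{U₀}ȟη‖ ≤ 2‖η‖`
    have hG := avgClosed_specialUnitary_of_le_twentyone (N := 2) (by norm_num) (F.P K).d (F.P K).L
    have hVmem : ∀ x κ, V x κ ∈ specialUnitaryUnits (Fin 2) := pull_toUField_mem U₀ (basePt F n K)
    have h52 : pdev V < 2 * ε₀ * ((((F.P K).L : ℝ) ^ (K - n))⁻¹) ^ 2 := pdev_pull_lt hε₀ (inAk_pull_of_regPr F hε₀.le hreg) (basePt F n K)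
    have hα2 : 2 * (2 * ε₀) ≤ c2' (F.P K).d (F.P K).L := by linarith
    have havg : ∀ j ≤ K - n, ∀ x κ, avgIter (F.P K).L V j x κ ∈ specialUnitaryUnits (Fin 2) :=
      avgIter_mem (F.P K).L hL2 hG (K - n) V hVmem (by positivity) hα3 hα2 h52
    have hU1 : ∀ j < K - n, ∀ x κ, avgIter (F.P K).L V j x κ ∈ U1 (Matrix (Fin 2) (Fin 2) ℂ) :=
      fun j hj x κ => hG.le_U1 (havg j hj.le x κ)
    have hpt : ∀ x, ‖hExt η x‖ ≤ ‖η‖ := fun x => by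
      rw [hExt_apply]
      exact (norm_ccExt_le (F.P K).L hU1 (top η) (coord x)).trans (norm_le_pi_norm η _)
    have h2 : 0 ≤ 2 * ‖η‖ := by positivity
    refine (pi_norm_le_iff_of_nonneg h2).2 fun b => ?_
    obtain ⟨hb1, hb2⟩ := hG.le_U1 (unitsField_toUField_mem U₀ b)
    have hconj : ‖((bgUnits F K U₀ b : (Matrix (Fin 2) (Fin 2) ℂ)ˣ) : Matrix (Fin 2) (Fin 2) ℂ) * hExt η b.tgt *
        (((bgUnits F K U₀ b)⁻¹ : (Matrix (Fin 2) (Fin 2) ℂ)ˣ) : Matrix (Fin 2) (Fin 2) ℂ)‖ ≤ ‖η‖ := by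
      calc _ ≤ ‖((bgUnits F K U₀ b : (Matrix (Fin 2) (Fin 2) ℂ)ˣ) : Matrix (Fin 2) (Fin 2) ℂ)‖ * ‖hExt η b.tgt‖ *
            ‖(((bgUnits F K U₀ b)⁻¹ : (Matrix (Fin 2) (Fin 2) ℂ)ˣ) : Matrix (Fin 2) (Fin 2) ℂ)‖ :=
            (norm_mul_le _ _).trans (mul_le_mul_of_nonneg_right (norm_mul_le _ _) (norm_nonneg _))
        _ ≤ 1 * ‖η‖ * 1 := by gcongr; exacts [hb1, hpt _, hb2]
        _ = ‖η‖ := by ring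
    calc ‖hExt η b.src - ((bgUnits F K U₀ b : (Matrix (Fin 2) (Fin 2) ℂ)ˣ) : Matrix (Fin 2) (Fin 2) ℂ) * hExt η b.tgt *
          (((bgUnits F K U₀ b)⁻¹ : (Matrix (Fin 2) (Fin 2) ℂ)ˣ) : Matrix (Fin 2) (Fin 2) ℂ)‖
        ≤ ‖hExt η b.src‖ + ‖((bgUnits F K U₀ b : (Matrix (Fin 2) (Fin 2) ℂ)ˣ) : Matrix (Fin 2) (Fin 2) ℂ) * hExt η b.tgt *
          (((bgUnits F K U₀ b)⁻¹ : (Matrix (Fin 2) (Fin 2) ℂ)ˣ) : Matrix (Fin 2) (Fin 2) ℂ)‖ := norm_sub_le _ _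
      _ ≤ ‖η‖ + ‖η‖ := add_le_add (hpt _) hconj
      _ = 2 * ‖η‖ := by ring

end Torus

end Summit.QuantumFields.YangMills.Theorems.Prop7SymAvgTwCovConstExt

end
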